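import Mathlib
import HarnessLib
import HarnessLib.Audit
import Summits.HubbardSuperconductivity.HubbardSuperconductivity.Theses.SeamInduction
import Summits.HubbardSuperconductivity.HubbardSuperconductivity.Theorems.SeamInductionSeamGluingLocalitySeamFlow
import Summits.HubbardSuperconductivity.HubbardSuperconductivity.Theorems.SeamInductionSeamGluingLocalityRegularity

/-!
# Line `seam-flow` for crux `SeamGluingLocality` (stmt-HubbardSuperconductivity-18509) —
# PART A: the repaired architecture (additive one-seam locality) still decides the summit

Crux-strategist workfile (`Cruxes/SeamGluingLocality/Lines/seam-flow.lean`), companion card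
`Lines/seam-flow.md`, negative note `NegativeGapExtensivity.lean`.

The technique with teeth for one-seam locality is the SEAM FLOW: on ONE carrier `Λ ≃ ℤ/L × ℤ/M`
write the glued tube as `H_M(θ) = H_⊕(θ) + V` with `H_⊕` the Hubbard Hamiltonian of the two-tube
graph (widths `M′`, `M″ = M − M′`, each periodically closed) and `V = H_M(0) − H_⊕(0)` the `8L`
seam-row bond terms (θ-independent: the twist sits on the seam COLUMN); telescoping
Hellmann–Feynman along `t ↦ H_⊕(θ) + tV` at `θ = π/3` and `θ = 0` and subtracting at equal `t`
bounds the twist-energy deficit `Δ_M − Δ_⊕` by the twist-SENSITIVITY of the seam energy `⟨V⟩_t`,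
which after gauge-spreading the twist (`e^{iπ/3L}` per bond) is a LOCAL quadratic response:
`O((π/3L)²)` per bond, `O(1/L)` in all, `O(1/M)` in stiffness units (Part B, stubs). This yields
locality with an ADDITIVE loss `C/M` for parts above a floor — NOT the crux's multiplicative,
unguarded, `(U,δ)`-universal form (which is over-strong: `NegativeGapExtensivity.lean`,
refuter notes SeamNonneg / SeamRepairCG on the item). Part A therefore first CERTIFIES that the
additive form suffices for the route:

* `UniformConstantsPerWidth` (B′): at one `(U, δ)`, all wide even widths have twist stiffness
  `≥ d`, inverse pair compressibility in `[d, k]`, each width in ITS OWN long-tube limit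
  (`L ≥ L₁(M)`, thresholds free to grow with `M`: a family of quasi-1D statements with uniform
  constants — strictly between `PerWidthThermodynamics` (constants per width) and
  `WidthUniformThermodynamics` (joint limit, `L₀` uniform));
* `CondAdditiveLocality`: for all `(U, δ, d, k)`, parts floored by `(d, k)` glue with additive
  losses `C(U,δ,d,k)/M` on stiffness and compressibility;
* `key_additive` (PROVED, abstract over the two functionals): B′ ∧ CondAdditiveLocality ⇒
  width-uniform thermodynamics, by strong induction on the width with the loss budget
  `ℓ(M) = 2C/M₁ − 2C/M ≤ d/2` (losses telescope along the merge tree because the larger part is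
  `≤ 2M/3`), base window `[M₁, 2M₁+2]`, `M₁ ≥ 4C/d`;
* `closes_additive` (PROVED): `WidthHaldaneBridge → UniformConstantsPerWidth →
  CondAdditiveLocality → HubbardSuperconductivity` (via `WidthHaldane.closes`).

Nothing here edits the route: it is evidence for the tenure planner's restate of item 18509.

LEAD UPDATE (line lead prover-line-stmt-HubbardSuperconductivity-18509-0, 2026-08-17): the two
provable-now tools are LANDED under `Theorems/` (`--supports` 18509) and discharged below —
`stub_seamFlow := Theorems.seamFlow_comparison` (p148339, `SeamInductionSeamGluingLocalitySeamFlow`)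
and `stub_regularity := Theorems.seamFlow_regularity` (p148777,
`SeamInductionSeamGluingLocalityRegularity`, which also provides `seamFlow_exists_unit_ground_pencil`,
the existence half of S3p's witnesses, and generic tube facts). Sorries = 4 = the physics stubs
S2 `stub_decoupledTwist`, S3 `stub_gluingTwistMonotone` (kept as an independent stub; it also
follows from S3p by `gluingTwistMonotone_of_pointwise stub_seamFlow stub_regularity`, whose two
tool arguments are now theorems), S3p `stub_seamTwistResponse`, S5 `stub_compressibilitySeam`.
Statements unchanged (this file still concludes the RESTATED crux `CondAdditiveLocality`, not
`SeamGluingLocality` as typed — see PICKED.md / STRATEGY-CENSUS.md).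
-/

namespace Summit.HubbardSuperconductivity.HubbardSuperconductivity.Cruxes.SeamGluingLocality.SeamFlow

open scoped BigOperators Topology Manifold Classical MeasureTheory ProbabilityTheory Matrix InnerProductSpace ComplexConjugate ContinuousMap
open Filter Set Function TopologicalSpace MeasureTheory
open Literature.Hubbard Literature.MathematicalPhysics.QuantumLattice
open Summit.HubbardSuperconductivity.HubbardSuperconductivity.Theses
open Summit.HubbardSuperconductivity.HubbardSuperconductivity.Theses.SeamInduction

/-- **B′ — uniform constants, per-width lengths.** There are `U > 0`, `δ ∈ (0,3/10)`, `d > 0`, `k`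
and `m₁` such that EVERY even width `M ≥ m₁` has a length threshold `L₁(M)` beyond which (all even
`L ≥ max(M, L₁(M))`, all labellings) the tube has twist stiffness per site `≥ d` and inverse pair
compressibility in `[d, k]`. Quasi-1D (each width in its own `L → ∞` limit), constants uniform in
the width. (Same let-prefix as the crux, verbatim.) [difficulty: open-problem] -/
def UniformConstantsPerWidth : Prop :=
open Matrix Literature.MathematicalPhysics.QuantumLattice in let H0 : ∀ (L M : ℕ) (Λ : Type) [LinearOrder Λ] [Fintype Λ], (Λ ≃ ZMod L × ZMod M) → ℝ → Matrix (Finset (Orb Λ)) (Finset (Orb Λ)) ℂ := fun _ _ Λ _ _ e U => hamiltonian (SimpleGraph.fromRel fun x y : Λ => y = e.symm ((e x).1 + 1, (e x).2) ∨ y = e.symm ((e x).1, (e x).2 + 1)) 1 U; let Tw : ∀ (L M : ℕ) [NeZero L] [NeZero M] (Λ : Type) [LinearOrder Λ] [Fintype Λ], (Λ ≃ ZMod L × ZMod M) → ℝ → Matrix (Finset (Orb Λ)) (Finset (Orb Λ)) ℂ := fun _ M _ _ _ _ _ e θ => ∑ b : ZMod M, ∑ σ : Fin 2, ((1 - Complex.exp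 (Complex.I * θ)) • (creation (orb (e.symm (0, b)) σ) * annihilation (orb (e.symm (-1, b)) σ)) + (1 - Complex.exp (-(Complex.I * θ))) • (creation (orb (e.symm (-1, b)) σ) * annihilation (orb (e.symm (0, b)) σ))); let E : ∀ (L M : ℕ) [NeZero L] [NeZero M] (Λ : Type) [LinearOrder Λ] [Fintype Λ], (Λ ≃ ZMod L × ZMod M) → ℝ → ℝ → ℕ → ℝ := fun L M _ _ Λ _ _ e U θ N => (H0 L M Λ e U + Tw L M Λ e θ).minEnergyOn (szSector N 0); let Np : ℕ → ℕ → ℝ → ℕ := fun L M δ => 2 * ⌊(1 - δ) * ((L : ℝ) * (M : ℝ)) / 2⌋₊; let stiff : ∀ (L M : ℕ) [NeZero L] [NeZero M] (Λ : Type) [LinearOrder Λ] [Fintype Λ], (Λ ≃ ZMod L × ZMod M) → ℝ → ℝ → ℝ := fun L M _ _ Λ _ _ e U δ => 2 * (L : ℝ) * (E L M Λ e U (Real.pi / 3) (Np L M δ) - E L M Λ e U 0 (Np L M δ)) / ((Real.pi / 3) ^ 2 * (M : ℝ)); let icomp : ∀ (L M : ℕ) [NeZero L] [NeZero M] (Λ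 : Type) [LinearOrder Λ] [Fintype Λ], (Λ ≃ ZMod L × ZMod M) → ℝ → ℝ → ℝ := fun L M _ _ Λ _ _ e U δ => (L : ℝ) * (M : ℝ) * (E L M Λ e U 0 (Np L M δ + 2) + E L M Λ e U 0 (Np L M δ - 2) - 2 * E L M Λ e U 0 (Np L M δ)) / 4; ∃ U : ℝ, 0 < U ∧ ∃ δ ∈ Set.Ioo (0 : ℝ) (3 / 10), ∃ d : ℝ, 0 < d ∧ ∃ k : ℝ, ∃ m₁ : ℕ, ∀ (M : ℕ) [NeZero M], Even M → m₁ ≤ M → ∃ L₁ : ℕ, ∀ (L : ℕ) [NeZero L], Even L → M ≤ L → L₁ ≤ L → ∀ (Λ : Type) [LinearOrder Λ] [Fintype Λ] (e : Λ ≃ ZMod L × ZMod M), d ≤ stiff L M Λ e U δ ∧ d ≤ icomp L M Λ e U δ ∧ icomp L M Λ e U δ ≤ k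

/-- **Conditional additive one-seam locality.** For every `U > 0`, `δ ∈ (0,3/10)` and floor data
`d > 0`, `k` there are a seam constant `C ≥ 0`, a handover width `m₀` and a length `L₂` such that
for all even `L ≥ L₂`, all even widths `M′, M″ ≥ m₀` with `M = M′ + M″ ≤ L` and all labellings of
the three tubes: IF both parts have stiffness `≥ d` and inverse pair compressibility in `[d, k]`,
THEN `stiff_M ≥ min(stiff′, stiff″) − C/M`, `icomp_M ≥ min(icomp′, icomp″) − C/M` and
`icomp_M ≤ max(icomp′, icomp″) + C/M` (seam loss `O(L)` bonds × `O(1/L²)` response per bond, in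
intensive units `C/M`). (Same let-prefix as the crux, verbatim.) [difficulty: XL] -/
def CondAdditiveLocality : Prop :=
open Matrix Literature.MathematicalPhysics.QuantumLattice in let H0 : ∀ (L M : ℕ) (Λ : Type) [LinearOrder Λ] [Fintype Λ], (Λ ≃ ZMod L × ZMod M) → ℝ → Matrix (Finset (Orb Λ)) (Finset (Orb Λ)) ℂ := fun _ _ Λ _ _ e U => hamiltonian (SimpleGraph.fromRel fun x y : Λ => y = e.symm ((e x).1 + 1, (e x).2) ∨ y = e.symm ((e x).1, (e x).2 + 1)) 1 U; let Tw : ∀ (L M : ℕ) [NeZero L] [NeZero M] (Λ : Type) [LinearOrder Λ] [Fintype Λ], (Λ ≃ ZMod L × ZMod M) → ℝ → Matrix (Finset (Orb Λ)) (Finset (Orb Λ)) ℂ := fun _ M _ _ _ _ _ e θ => ∑ b : ZMod M, ∑ σ : Fin 2, ((1 - Complex.exp (Complex.I * θ)) • (creation (orb (e.symm (0, b)) σ) * annihilation (orb (e.symm (-1, b)) σ)) + (1 - Complex.exp (-(Complex.I * θ))) • (creation (orb (e.symm (-1, b)) σ) * annihilation (orb (e.symm (0, b)) σ))); let E : ∀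 (L M : ℕ) [NeZero L] [NeZero M] (Λ : Type) [LinearOrder Λ] [Fintype Λ], (Λ ≃ ZMod L × ZMod M) → ℝ → ℝ → ℕ → ℝ := fun L M _ _ Λ _ _ e U θ N => (H0 L M Λ e U + Tw L M Λ e θ).minEnergyOn (szSector N 0); let Np : ℕ → ℕ → ℝ → ℕ := fun L M δ => 2 * ⌊(1 - δ) * ((L : ℝ) * (M : ℝ)) / 2⌋₊; let stiff : ∀ (L M : ℕ) [NeZero L] [NeZero M] (Λ : Type) [LinearOrder Λ] [Fintype Λ], (Λ ≃ ZMod L × ZMod M) → ℝ → ℝ → ℝ := fun L M _ _ Λ _ _ e U δ => 2 * (L : ℝ) * (E L M Λ e U (Real.pi / 3) (Np L M δ) - E L M Λ e U 0 (Np L M δ)) / ((Real.pi / 3) ^ 2 * (M : ℝ)); let icomp : ∀ (L M : ℕ) [NeZero L] [NeZero M] (Λ : Type) [LinearOrder Λ] [Fintype Λ], (Λ ≃ ZMod L × ZMod M) → ℝ → ℝ → ℝ := fun L M _ _ Λ _ _ e U δ => (L : ℝ) * (M : ℝ) * (E L M Λ e U 0 (Np L M δ + 2) + E L M Λ e U 0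 (Np L M δ - 2) - 2 * E L M Λ e U 0 (Np L M δ)) / 4; ∀ U : ℝ, 0 < U → ∀ δ ∈ Set.Ioo (0 : ℝ) (3 / 10), ∀ d k : ℝ, 0 < d → ∃ C : ℝ, 0 ≤ C ∧ ∃ m₀ L₂ : ℕ, ∀ (L M' M'' M : ℕ) [NeZero L] [NeZero M'] [NeZero M''] [NeZero M], Even L → Even M' → Even M'' → m₀ ≤ M' → m₀ ≤ M'' → M' + M'' = M → M ≤ L → L₂ ≤ L → ∀ (Λ' : Type) [LinearOrder Λ'] [Fintype Λ'] (e' : Λ' ≃ ZMod L × ZMod M') (Λ'' : Type) [LinearOrder Λ''] [Fintype Λ''] (e'' : Λ'' ≃ ZMod L × ZMod M'') (Λ : Type) [LinearOrder Λ] [Fintype Λ] (e : Λ ≃ ZMod L × ZMod M), d ≤ stiff L M' Λ' e' U δ → d ≤ stiff L M'' Λ'' e'' U δ → d ≤ icomp L M' Λ' e' U δ → d ≤ icomp L M'' Λ'' e'' U δ → icomp L M' Λ' e' U δ ≤ k → icomp L M'' Λ'' e'' U δ ≤ k → min (stiff L M' Λ' e' U δ) (stiff L M'' Λ'' e'' U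 δ) - C / M ≤ stiff L M Λ e U δ ∧ min (icomp L M' Λ' e' U δ) (icomp L M'' Λ'' e'' U δ) - C / M ≤ icomp L M Λ e U δ ∧ icomp L M Λ e U δ ≤ max (icomp L M' Λ' e' U δ) (icomp L M'' Λ'' e'' U δ) + C / M

/-- **The additive width induction** (abstract over the two response functionals `ρ`, `κ`):
uniform constants per width (B′) and conditional additive locality give width-UNIFORM bounds
`ρ ≥ d/2`, `0 < κ ≤ k + d/2` on all even widths `M₁ ≤ M ≤ L`, `L ≥ L₀`. Strong induction on `M`
with loss budget `ℓ(M) = 2C/M₁ − 2C/M`: base window `[M₁, 2M₁+2]` (finitely many widths, `L₀` the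
max of their thresholds), step `M ↦ (2⌊M/4⌋, M − 2⌊M/4⌋)` whose larger part is `≤ 2M/3`, so
`ℓ(part) + C/M ≤ ℓ(M)`; `M₁ ≥ 4C/d` keeps `ℓ ≤ d/2`. [folklore] -/
theorem key_additive (ρ κ : ∀ (L M : ℕ) [NeZero L] [NeZero M] (Λ : Type) [LinearOrder Λ] [Fintype Λ], (Λ ≃ ZMod L × ZMod M) → ℝ → ℝ → ℝ)
    (hA : ∃ U : ℝ, 0 < U ∧ ∃ δ ∈ Set.Ioo (0 : ℝ) (3 / 10), ∃ d : ℝ, 0 < d ∧ ∃ k : ℝ, ∃ m₁ : ℕ,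
      ∀ (M : ℕ) [NeZero M], Even M → m₁ ≤ M → ∃ L₁ : ℕ, ∀ (L : ℕ) [NeZero L], Even L → M ≤ L →
        L₁ ≤ L → ∀ (Λ : Type) [LinearOrder Λ] [Fintype Λ] (e : Λ ≃ ZMod L × ZMod M),
          d ≤ ρ L M Λ e U δ ∧ d ≤ κ L M Λ e U δ ∧ κ L M Λ e U δ ≤ k)
    (hB : ∀ U : ℝ, 0 < U → ∀ δ ∈ Set.Ioo (0 : ℝ) (3 / 10), ∀ d k : ℝ, 0 < d → ∃ C : ℝ, 0 ≤ C ∧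
      ∃ m₀ L₂ : ℕ, ∀ (L M' M'' M : ℕ) [NeZero L] [NeZero M'] [NeZero M''] [NeZero M],
        Even L → Even M' → Even M'' → m₀ ≤ M' → m₀ ≤ M'' → M' + M'' = M → M ≤ L → L₂ ≤ L →
        ∀ (Λ' : Type) [LinearOrder Λ'] [Fintype Λ'] (e' : Λ' ≃ ZMod L × ZMod M')
          (Λ'' : Type) [LinearOrder Λ''] [Fintype Λ''] (e'' : Λ'' ≃ ZMod L × ZMod M'')
          (Λ : Type) [LinearOrder Λ] [Fintype Λ] (e : Λ ≃ ZMod L × ZMod M),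
          d ≤ ρ L M' Λ' e' U δ → d ≤ ρ L M'' Λ'' e'' U δ → d ≤ κ L M' Λ' e' U δ →
          d ≤ κ L M'' Λ'' e'' U δ → κ L M' Λ' e' U δ ≤ k → κ L M'' Λ'' e'' U δ ≤ k →
            min (ρ L M' Λ' e' U δ) (ρ L M'' Λ'' e'' U δ) - C / M ≤ ρ L M Λ e U δ ∧
            min (κ L M' Λ' e' U δ) (κ L M'' Λ'' e'' U δ) - C / M ≤ κ L M Λ e U δ ∧
            κ L M Λ e U δ ≤ max (κ L M' Λ' e' U δ) (κ L M'' Λ'' e'' U δ) + C / M) :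
    ∃ U : ℝ, 0 < U ∧ ∃ δ ∈ Set.Ioo (0 : ℝ) (3 / 10), ∃ d₀ : ℝ, 0 < d₀ ∧ ∃ k₀ : ℝ, ∃ M₁ L₀ : ℕ,
      ∀ (L M : ℕ) [NeZero L] [NeZero M], Even L → Even M → M₁ ≤ M → M ≤ L → L₀ ≤ L →
        ∀ (Λ : Type) [LinearOrder Λ] [Fintype Λ] (e : Λ ≃ ZMod L × ZMod M),
          d₀ ≤ ρ L M Λ e U δ ∧ 0 < κ L M Λ e U δ ∧ κ L M Λ e U δ ≤ k₀ := by
  obtain ⟨U, hU, δ, hδ, d, hd, k, m₁, hA⟩ := hA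
  obtain ⟨C, hC, m₀, L₂, hB⟩ := hB U hU δ hδ (d / 2) (k + d / 2) (by positivity)
  -- non-dependent choice of the per-width length thresholds
  have hA' : ∀ M : ℕ, ∃ L₁ : ℕ, Even M → m₁ ≤ M →
      ∀ L : ℕ, Even L → M ≤ L → L₁ ≤ L → ∀ (iL : NeZero L) (iM : NeZero M)
        (Λ : Type) [LinearOrder Λ] [Fintype Λ] (e : Λ ≃ ZMod L × ZMod M),
          d ≤ ρ L M Λ e U δ ∧ d ≤ κ L M Λ e U δ ∧ κ L M Λ e U δ ≤ k := by
    intro M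
    by_cases h : Even M ∧ m₁ ≤ M ∧ 0 < M
    · haveI : NeZero M := ⟨by omega⟩
      obtain ⟨L₁, h1⟩ := hA M h.1 h.2.1
      exact ⟨L₁, fun _ _ L hLe hML hL1 iL iM Λ _ _ e => h1 L hLe hML hL1 Λ e⟩
    · refine ⟨0, fun h1 h2 L _ _ _ iL iM Λ _ _ e => ?_⟩
      exact (h ⟨h1, h2, Nat.pos_of_ne_zero (NeZero.ne M)⟩).elim
  choose L₁ hL₁ using hA'
  -- the base width M₁: even, ≥ m₁, ≥ m₀, ≥ 6 and ≥ 4C/d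
  obtain ⟨M₁, hM₁E, hM₁m₁, hM₁m₀, hM₁6, hM₁C⟩ :
      ∃ M₁ : ℕ, Even M₁ ∧ m₁ ≤ M₁ ∧ m₀ ≤ M₁ ∧ 6 ≤ M₁ ∧ 4 * C / d ≤ M₁ := by
    refine ⟨2 * (m₁ + m₀ + ⌈4 * C / d⌉₊ + 3), even_two_mul _, by omega, by omega, by omega, ?_⟩
    have h1 : 4 * C / d ≤ ⌈4 * C / d⌉₊ := Nat.le_ceil _
    have h2 : ((⌈4 * C / d⌉₊ : ℕ) : ℝ) ≤ (2 * (m₁ + m₀ + ⌈4 * C / d⌉₊ + 3) : ℕ) := by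
      exact_mod_cast (show ⌈4 * C / d⌉₊ ≤ 2 * (m₁ + m₀ + ⌈4 * C / d⌉₊ + 3) by omega)
    exact h1.trans h2
  set I : Finset ℕ := Finset.range (M₁ / 2 + 2) with hI
  set w : ℕ → ℕ := fun i => M₁ + 2 * i with hw
  set L₀ : ℕ := max (I.sup fun i => L₁ (w i)) L₂ with hL₀
  have hwE : ∀ i, Even (w i) := fun i => by
    obtain ⟨r, hr⟩ := hM₁E; exact ⟨r + i, by simp only [hw]; omega⟩
  have hwm : ∀ i, m₁ ≤ w i := fun i => by simp only [hw]; omega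
  have hLb : ∀ i ∈ I, L₁ (w i) ≤ L₀ := fun i hi =>
    (Finset.le_sup (f := fun i => L₁ (w i)) hi).trans (le_max_left _ _)
  have hM₁0 : (0 : ℝ) < M₁ := by exact_mod_cast (show 0 < M₁ by omega)
  -- loss budget
  set ℓ : ℝ → ℝ := fun x => 2 * C / M₁ - 2 * C / x with hℓ
  have hℓ0 : ∀ x : ℝ, (M₁ : ℝ) ≤ x → 0 ≤ ℓ x := by
    intro x hx
    have hx0 : 0 < x := hM₁0.trans_le hx
    simp only [hℓ, sub_nonneg]
    exact div_le_div_of_nonneg_left (by positivity) hM₁0 hx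
  have hℓtop : ∀ x : ℝ, (M₁ : ℝ) ≤ x → ℓ x ≤ d / 2 := by
    intro x hx
    have hx0 : 0 < x := hM₁0.trans_le hx
    have h1 : 2 * C / (M₁ : ℝ) ≤ d / 2 := by
      rw [div_le_iff₀ hM₁0]
      have := hM₁C; rw [div_le_iff₀ hd] at this; linarith
    have h2 : 0 ≤ 2 * C / x := by positivity
    simp only [hℓ]; linarith
  have hℓmono : ∀ x y : ℝ, 0 < x → x ≤ y → ℓ x ≤ ℓ y := by
    intro x y hx hxy
    simp only [hℓ]
    have : 2 * C / y ≤ 2 * C / x := div_le_div_of_nonneg_left (by positivity) hx hxy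
    linarith
  have hℓstep : ∀ x y : ℝ, 0 < x → 3 * x ≤ 2 * y → ℓ x + C / y ≤ ℓ y := by
    intro x y hx hxy
    have hy : 0 < y := by linarith
    simp only [hℓ]
    have : C / y + 2 * C / y ≤ 2 * C / x := by
      rw [← add_div, div_le_div_iff₀ hy hx]; nlinarith
    linarith
  -- the induction
  have main : ∀ M : ℕ, Even M → M₁ ≤ M → ∀ L : ℕ, Even L → M ≤ L → L₀ ≤ L →
      ∀ (iL : NeZero L) (iM : NeZero M) (Λ : Type) [LinearOrder Λ] [Fintype Λ]
        (e : Λ ≃ ZMod L × ZMod M),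
        d - ℓ M ≤ ρ L M Λ e U δ ∧ d - ℓ M ≤ κ L M Λ e U δ ∧ κ L M Λ e U δ ≤ k + ℓ M := by
    intro M
    induction M using Nat.strong_induction_on with
    | _ M ih =>
      intro hMe hM₁M L hLe hML hL₀L iL iM Λ _ _ e
      have hM₁R : (M₁ : ℝ) ≤ M := by exact_mod_cast hM₁M
      have hM0 : (0 : ℝ) < M := hM₁0.trans_le hM₁R
      have hL₂L : L₂ ≤ L := le_trans (le_max_right _ _) hL₀L
      by_cases hb : M ≤ 2 * M₁ + 2
      · obtain ⟨i, hiI, hwi⟩ : ∃ i ∈ I, w i = M := by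
          obtain ⟨r, hr⟩ := hMe; obtain ⟨r₁, hr₁⟩ := hM₁E
          exact ⟨(M - M₁) / 2, by simp only [hI, Finset.mem_range]; omega, by simp only [hw]; omega⟩
        subst hwi
        obtain ⟨h1, h2, h3⟩ := hL₁ (w i) (hwE i) (hwm i) L hLe hML ((hLb i hiI).trans hL₀L) iL iM Λ e
        have h0 := hℓ0 (w i) hM₁R
        exact ⟨by linarith, by linarith, by linarith⟩
      · replace hb := not_le.mp hb
        set M' : ℕ := 2 * (M / 4) with hM'
        set M'' : ℕ := M - M' with hM''
        obtain ⟨r, hr⟩ := hMe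
        haveI iM' : NeZero M' := ⟨by omega⟩
        haveI iM'' : NeZero M'' := ⟨by omega⟩
        have car : ∀ (a b : ℕ) [NeZero a] [NeZero b], ∃ e : Fin (a * b) ≃ ZMod a × ZMod b, True :=
          fun a b _ _ => ⟨finProdFinEquiv.symm.trans
            (Equiv.prodCongr (ZMod.finEquiv a).toEquiv (ZMod.finEquiv b).toEquiv), trivial⟩
        obtain ⟨e', -⟩ := car L M'
        obtain ⟨e'', -⟩ := car L M''
        have hM'E : Even M' := ⟨M / 4, by omega⟩
        have hM''E : Even M'' := ⟨r - M / 4, by omega⟩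
        obtain ⟨l', p', u'⟩ := ih M' (by omega) hM'E (by omega) L hLe (by omega) hL₀L iL iM'
          (Fin (L * M')) e'
        obtain ⟨l'', p'', u''⟩ := ih M'' (by omega) hM''E (by omega) L hLe (by omega) hL₀L iL iM''
          (Fin (L * M'')) e''
        have hM'R : (M₁ : ℝ) ≤ M' := by exact_mod_cast (show M₁ ≤ M' by omega)
        have hM''R : (M₁ : ℝ) ≤ M'' := by exact_mod_cast (show M₁ ≤ M'' by omega)
        have hM'0 : (0 : ℝ) < M' := hM₁0.trans_le hM'R
        have hM''0 : (0 : ℝ) < M'' := hM₁0.trans_le hM''R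
        have h3M' : 3 * (M' : ℝ) ≤ 2 * M := by exact_mod_cast (show 3 * M' ≤ 2 * M by omega)
        have h3M'' : 3 * (M'' : ℝ) ≤ 2 * M := by exact_mod_cast (show 3 * M'' ≤ 2 * M by omega)
        have t' := hℓtop M' hM'R
        have t'' := hℓtop M'' hM''R
        obtain ⟨g1, g2, g3⟩ := hB L M' M'' M hLe hM'E hM''E (by omega) (by omega) (by omega) hML hL₂L
          (Fin (L * M')) e' (Fin (L * M'')) e'' Λ e
          (by linarith) (by linarith) (by linarith) (by linarith) (by linarith) (by linarith)
        have s' := hℓstep M' M hM'0 h3M'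
        have s'' := hℓstep M'' M hM''0 h3M''
        refine ⟨?_, ?_, ?_⟩
        · refine le_trans ?_ g1
          rcases le_total (ρ L M' (Fin (L * M')) e' U δ) (ρ L M'' (Fin (L * M'')) e'' U δ) with h | h
          · rw [min_eq_left h]; linarith
          · rw [min_eq_right h]; linarith
        · refine le_trans ?_ g2
          rcases le_total (κ L M' (Fin (L * M')) e' U δ) (κ L M'' (Fin (L * M'')) e'' U δ) with h | h
          · rw [min_eq_left h]; linarith
          · rw [min_eq_right h]; linarith
        · refine g3.trans ?_
          rcases le_total (κ L M' (Fin (L * M')) e' U δ) (κ L M'' (Fin (L * M'')) e'' U δ) with h | h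
          · rw [max_eq_right h]; linarith
          · rw [max_eq_left h]; linarith
  refine ⟨U, hU, δ, hδ, d / 2, by positivity, k + d / 2, M₁, L₀, ?_⟩
  intro L M iL iM hLe hMe hM₁M hML hL₀L Λ _ _ e
  obtain ⟨h1, h2, h3⟩ := main M hMe hM₁M L hLe hML hL₀L iL iM Λ e
  have hM₁R : (M₁ : ℝ) ≤ M := by exact_mod_cast hM₁M
  have t := hℓtop M hM₁R
  exact ⟨by linarith, by linarith, by linarith⟩

/-- **The repaired route still decides the summit**: the shared crux `WidthHaldaneBridge`, B′ and
conditional additive locality give `HubbardSuperconductivity` — `key_additive` instantiated at the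
twist stiffness and the inverse pair compressibility IS `WidthUniformThermodynamics`, then the
parent route's certified `WidthHaldane.closes`. [folklore] -/
theorem closes_additive (h1 : WidthHaldaneBridge) (hA : UniformConstantsPerWidth)
    (hL : CondAdditiveLocality) : _root_.HubbardSuperconductivity :=
  Summit.HubbardSuperconductivity.HubbardSuperconductivity.Theses.WidthHaldane.closes h1
    (key_additive _ _ hA hL)


/-! ## PART B — the seam-flow line for `CondAdditiveLocality` (stubs + kernel-checked composition)

Objects (extended let-prefix, verbatim crux prefix + two lets): on the carrier `Λ ≃ ℤ/L × ℤ/M` of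
the glued tube and for a split width `M′`, `Hs` is the Hubbard Hamiltonian of the TWO-TUBE graph
(rows `0 … M′−1` closed periodically onto themselves, rows `M′ … M−1` likewise; the longitudinal
bonds unchanged), `Es` its twisted sector energies; the seam operator is `V = H0 − Hs` (the `8L`
hopping terms on the four re-wired transverse bond rows, θ-INDEPENDENT), so that
`H0 + Tw θ = (Hs + Tw θ) + V` for every twist `θ`.

Stubs: `stub_decoupledTwist` (S2: the decoupled glued system's twist energy dominates the
width-weighted parts': fermionic embedding of the parts + particle-distribution control — physics,
L), `stub_gluingTwistMonotone` (S3: closing the seam lowers the twist energy by at most `O(1/L)` —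
THE load-bearing seam stub, physics, XL), `stub_compressibilitySeam` (S5: the two compressibility
conjuncts, kept coarse; sub-plan in the card) ⇒ `condAdditiveLocality_of` (PROVED). Tools for S3:
`stub_seamFlow` (S1: abstract telescoping Hellmann–Feynman comparison, provable now),
`stub_regularity` (S4: hermiticity / sector invariance / non-empty sector, provable now) and the
sharper pointwise `stub_seamTwistResponse` (S3p: twist-sensitivity of the seam energy at every
partial coupling `t ∈ (0,1]` is `O(1/L)`, XL) ⇒ `gluingTwistMonotone_of_pointwise` (PROVED).
-/

/-- STUB S1 (abstract; LANDED as `Theorems.seamFlow_comparison`, p148339). **Seam flow / telescoping Hellmann–Feynman.** For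
Hermitian `A, B, V` leaving a nonzero subspace `K` invariant: if at every partial coupling
`t ∈ (0,1]` SOME `K`-ground states `φ` of `A + tV` and `ψ` of `B + tV` satisfy
`⟨φ,Vφ⟩ ≤ ⟨ψ,Vψ⟩ + ε`, then `E_K(B) − E_K(A) ≤ E_K(B+V) − E_K(A+V) + ε`. Proof idea: for a grid
step `h`, `E(B+(t+h)V) − E(B+tV) ≥ h⟨V⟩_{ψ_{t+h}}` and `E(A+(t+h)V) − E(A+tV) ≤ h⟨V⟩_{φ_t}`
(variational principle with the neighbouring ground state, ANY choice of ground states), so with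
the witnesses at the grid points `h, 2h, …, 1` the differences telescope up to the boundary term
`h(⟨V⟩_{φ_1} − ⟨V⟩_{φ_0}) ≥ −2h‖V‖`; let `h → 0` (`t = 0` is never used as a witness point).
[folklore] -/
def StubSeamFlow : Prop :=
  ∀ {n : Type} [Fintype n] [DecidableEq n] (K : Submodule ℂ (n → ℂ)) (A B V : Matrix n n ℂ) (ε : ℝ),
    A.IsHermitian → B.IsHermitian → V.IsHermitian →
    (∀ v ∈ K, A *ᵥ v ∈ K) → (∀ v ∈ K, B *ᵥ v ∈ K) → (∀ v ∈ K, V *ᵥ v ∈ K) → K ≠ ⊥ →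
    (∀ t ∈ Set.Ioc (0 : ℝ) 1, ∃ φ ψ : n → ℂ, φ ∈ K ∧ ψ ∈ K ∧ star φ ⬝ᵥ φ = 1 ∧ star ψ ⬝ᵥ ψ = 1 ∧
      (star φ ⬝ᵥ (A + (t : ℂ) • V) *ᵥ φ).re = (A + (t : ℂ) • V).minEnergyOn K ∧
      (star ψ ⬝ᵥ (B + (t : ℂ) • V) *ᵥ ψ).re = (B + (t : ℂ) • V).minEnergyOn K ∧
      (star φ ⬝ᵥ V *ᵥ φ).re ≤ (star ψ ⬝ᵥ V *ᵥ ψ).re + ε) →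
    B.minEnergyOn K - A.minEnergyOn K ≤ (B + V).minEnergyOn K - (A + V).minEnergyOn K + ε

theorem stub_seamFlow : StubSeamFlow := fun K A B V ε _ _ _ _ _ _ hK hw =>
  Summit.HubbardSuperconductivity.HubbardSuperconductivity.Theorems.seamFlow_comparison K A B V ε hK hw

/-- STUB S4 (LANDED as `Theorems.seamFlow_regularity`, p148777). **Regularity of the glued / decoupled tube Hamiltonians**: the
twisted two-tube Hamiltonian `Hs + Tw θ` and the seam operator `H0 − Hs` are Hermitian and leave
every `(N, S^z = 0)` sector invariant (they are sums of `c†_{xσ} c_{yσ}` hoppings, their adjoints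
and `n↑n↓` terms), and the nominal sector `(N_{L,M}, 0)` is non-empty (`N_{L,M} ≤ LM`, place
`N/2` up- and `N/2` down-electrons). [folklore] -/
def StubRegularity : Prop :=
open Matrix Literature.MathematicalPhysics.QuantumLattice in let H0 : ∀ (L M : ℕ) (Λ : Type) [LinearOrder Λ] [Fintype Λ], (Λ ≃ ZMod L × ZMod M) → ℝ → Matrix (Finset (Orb Λ)) (Finset (Orb Λ)) ℂ := fun _ _ Λ _ _ e U => hamiltonian (SimpleGraph.fromRel fun x y : Λ => y = e.symm ((e x).1 + 1, (e x).2) ∨ y = e.symm ((e x).1, (e x).2 + 1)) 1 U; let Tw : ∀ (L M : ℕ) [NeZero L] [NeZero M] (Λ : Type) [LinearOrder Λ] [Fintype Λ], (Λ ≃ ZMod L × ZMod M) → ℝ → Matrix (Finset (Orb Λ)) (Finset (Orb Λ)) ℂ := fun _ M _ _ _ _ _ e θ => ∑ b : ZMod M, ∑ σ : Fin 2, ((1 - Complex.exp (Complex.I * θ)) • (creation (orb (e.symm (0, b)) σ) * annihilation (orb (e.symm (-1, b)) σ)) + (1 - Complex.exp (-(Complex.I * θ))) • (creation (orb (e.symm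 (-1, b)) σ) * annihilation (orb (e.symm (0, b)) σ))); let E : ∀ (L M : ℕ) [NeZero L] [NeZero M] (Λ : Type) [LinearOrder Λ] [Fintype Λ], (Λ ≃ ZMod L × ZMod M) → ℝ → ℝ → ℕ → ℝ := fun L M _ _ Λ _ _ e U θ N => (H0 L M Λ e U + Tw L M Λ e θ).minEnergyOn (szSector N 0); let Np : ℕ → ℕ → ℝ → ℕ := fun L M δ => 2 * ⌊(1 - δ) * ((L : ℝ) * (M : ℝ)) / 2⌋₊; let stiff : ∀ (L M : ℕ) [NeZero L] [NeZero M] (Λ : Type) [LinearOrder Λ] [Fintype Λ], (Λ ≃ ZMod L × ZMod M) → ℝ → ℝ → ℝ := fun L M _ _ Λ _ _ e U δ => 2 * (L : ℝ) * (E L M Λ e U (Real.pi / 3) (Np L M δ) - E L M Λ e U 0 (Np L M δ)) / ((Real.pi / 3) ^ 2 * (M : ℝ)); let icomp : ∀ (L M : ℕ) [NeZero L] [NeZero M] (Λ : Type) [LinearOrder Λ] [Fintype Λ], (Λ ≃ ZMod L × ZMod M) → ℝ → ℝ → ℝ := fun L M _ _ Λ _ _ e U δ => (L : ℝ) * (M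 : ℝ) * (E L M Λ e U 0 (Np L M δ + 2) + E L M Λ e U 0 (Np L M δ - 2) - 2 * E L M Λ e U 0 (Np L M δ)) / 4; let Hs : ∀ (L M : ℕ) [NeZero M] (Λ : Type) [LinearOrder Λ] [Fintype Λ], (Λ ≃ ZMod L × ZMod M) → ℕ → ℝ → Matrix (Finset (Orb Λ)) (Finset (Orb Λ)) ℂ := fun _ M _ Λ _ _ e M' U => hamiltonian (SimpleGraph.fromRel fun x y : Λ => y = e.symm ((e x).1 + 1, (e x).2) ∨ (((e x).2.val + 1 ≠ M' ∧ (e x).2.val + 1 ≠ M) ∧ y = e.symm ((e x).1, (e x).2 + 1)) ∨ ((e x).2.val + 1 = M' ∧ y = e.symm ((e x).1, 0)) ∨ ((e x).2.val + 1 = M ∧ y = e.symm ((e x).1, ((M' : ℕ) : ZMod M)))) 1 U; let Es : ∀ (L M : ℕ) [NeZero L] [NeZero M] (Λ : Type) [LinearOrder Λ] [Fintype Λ], (Λ ≃ ZMod L × ZMod M) → ℕ → ℝ → ℝ → ℕ → ℝ := fun L M _ _ Λ _ _ e M' U θ N => (Hs L M Λ e M' U + Tw L M Λ e θ).minEnergyOn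 (szSector N 0); ∀ (L M : ℕ) [NeZero L] [NeZero M] (Λ : Type) [LinearOrder Λ] [Fintype Λ] (e : Λ ≃ ZMod L × ZMod M) (M' : ℕ) (U θ : ℝ) (N : ℕ), (Hs L M Λ e M' U + Tw L M Λ e θ).IsHermitian ∧ (H0 L M Λ e U - Hs L M Λ e M' U).IsHermitian ∧ (∀ v : Fock (Orb Λ), v ∈ szSector N 0 → (Hs L M Λ e M' U + Tw L M Λ e θ) *ᵥ v ∈ szSector N 0) ∧ (∀ v : Fock (Orb Λ), v ∈ szSector N 0 → (H0 L M Λ e U - Hs L M Λ e M' U) *ᵥ v ∈ szSector N 0) ∧ (∀ δ ∈ Set.Ioo (0 : ℝ) (3 / 10), (szSector (Np L M δ) 0 : Submodule ℂ (Fock (Orb Λ))) ≠ ⊥)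

theorem stub_regularity : StubRegularity :=
  Summit.HubbardSuperconductivity.HubbardSuperconductivity.Theorems.seamFlow_regularity

/-- STUB S2 (physics + fermionic embedding; L). **Decoupled twist energy dominates the parts'.**
In the decoupled glued system `Hs` (two tubes on one carrier, sharing only the total particle
number and `S^z`), the twist energy in the nominal sector is at least the sum of the parts'
twist energies at their nominal fillings, `(π/3)²(M′·stiff′ + M″·stiff″)/(2L)`, up to a seam-size
loss `(π/3)²·C/(2L)` — for parts floored by `(d, k)`. Content: (i) `Hs ≅ H′ ⊗ 1 + 1 ⊗ H″` along
the fermionic embedding of the two part-carriers (Jordan–Wigner signs are harmless: each term is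
even), so `Es(θ, N) = min_{N′+N″=N, s′+s″=0} E′(θ,N′,s′) + E″(θ,N″,s″)`; (ii) DISTRIBUTION CONTROL:
the minimising split puts densities within `O(1/M′)` of `1 − δ` into each tube, and the parts'
twist energies are robust there (why it might fail: the crux's `stiff` is read at ONE filling per
`L`; robustness in a density window is extra per-width input — see card). [difficulty: L] -/
def StubDecoupledTwist : Prop :=
open Matrix Literature.MathematicalPhysics.QuantumLattice in let H0 : ∀ (L M : ℕ) (Λ : Type) [LinearOrder Λ] [Fintype Λ], (Λ ≃ ZMod L × ZMod M) → ℝ → Matrix (Finset (Orb Λ)) (Finset (Orb Λ)) ℂ := fun _ _ Λ _ _ e U => hamiltonian (SimpleGraph.fromRel fun x y : Λ => y = e.symm ((e x).1 + 1, (e x).2) ∨ y = e.symm ((e x).1, (e x).2 + 1)) 1 U; let Tw : ∀ (L M : ℕ) [NeZero L] [NeZero M] (Λ : Type) [LinearOrder Λ] [Fintype Λ], (Λ ≃ ZMod L × ZMod M) → ℝ → Matrix (Finset (Orb Λ)) (Finset (Orb Λ)) ℂ := fun _ M _ _ _ _ _ e θ => ∑ b : ZMod M, ∑ σ : Fin 2,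 ((1 - Complex.exp (Complex.I * θ)) • (creation (orb (e.symm (0, b)) σ) * annihilation (orb (e.symm (-1, b)) σ)) + (1 - Complex.exp (-(Complex.I * θ))) • (creation (orb (e.symm (-1, b)) σ) * annihilation (orb (e.symm (0, b)) σ))); let E : ∀ (L M : ℕ) [NeZero L] [NeZero M] (Λ : Type) [LinearOrder Λ] [Fintype Λ], (Λ ≃ ZMod L × ZMod M) → ℝ → ℝ → ℕ → ℝ := fun L M _ _ Λ _ _ e U θ N => (H0 L M Λ e U + Tw L M Λ e θ).minEnergyOn (szSector N 0); let Np : ℕ → ℕ → ℝ → ℕ := fun L M δ => 2 * ⌊(1 - δ) * ((L : ℝ) * (M : ℝ)) / 2⌋₊; let stiff : ∀ (L M : ℕ) [NeZero L] [NeZero M] (Λ : Type) [LinearOrder Λ] [Fintype Λ], (Λ ≃ ZMod L × ZMod M) → ℝ → ℝ → ℝ := fun L M _ _ Λ _ _ e U δ => 2 * (L : ℝ) * (E L M Λ e U (Real.pi / 3) (Np L M δ) - E L M Λ e U 0 (Np L M δ)) / ((Real.pi / 3) ^ 2 * (M : ℝ)); let icomp : ∀ (L M : ℕ) [NeZero L]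 [NeZero M] (Λ : Type) [LinearOrder Λ] [Fintype Λ], (Λ ≃ ZMod L × ZMod M) → ℝ → ℝ → ℝ := fun L M _ _ Λ _ _ e U δ => (L : ℝ) * (M : ℝ) * (E L M Λ e U 0 (Np L M δ + 2) + E L M Λ e U 0 (Np L M δ - 2) - 2 * E L M Λ e U 0 (Np L M δ)) / 4; let Hs : ∀ (L M : ℕ) [NeZero M] (Λ : Type) [LinearOrder Λ] [Fintype Λ], (Λ ≃ ZMod L × ZMod M) → ℕ → ℝ → Matrix (Finset (Orb Λ)) (Finset (Orb Λ)) ℂ := fun _ M _ Λ _ _ e M' U => hamiltonian (SimpleGraph.fromRel fun x y : Λ => y = e.symm ((e x).1 + 1, (e x).2) ∨ (((e x).2.val + 1 ≠ M' ∧ (e x).2.val + 1 ≠ M) ∧ y = e.symm ((e x).1, (e x).2 + 1)) ∨ ((e x).2.val + 1 = M' ∧ y = e.symm ((e x).1, 0)) ∨ ((e x).2.val + 1 = M ∧ y = e.symm ((e x).1, ((M' : ℕ) : ZMod M)))) 1 U; let Es : ∀ (L M : ℕ) [NeZero L] [NeZero M] (Λ : Type) [LinearOrder Λ] [Fintype Λ],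 (Λ ≃ ZMod L × ZMod M) → ℕ → ℝ → ℝ → ℕ → ℝ := fun L M _ _ Λ _ _ e M' U θ N => (Hs L M Λ e M' U + Tw L M Λ e θ).minEnergyOn (szSector N 0); ∀ U : ℝ, 0 < U → ∀ δ ∈ Set.Ioo (0 : ℝ) (3 / 10), ∀ d k : ℝ, 0 < d → ∃ C : ℝ, 0 ≤ C ∧ ∃ m₀ L₂ : ℕ, ∀ (L M' M'' M : ℕ) [NeZero L] [NeZero M'] [NeZero M''] [NeZero M], Even L → Even M' → Even M'' → m₀ ≤ M' → m₀ ≤ M'' → M' + M'' = M → M ≤ L → L₂ ≤ L → ∀ (Λ' : Type) [LinearOrder Λ'] [Fintype Λ'] (e' : Λ' ≃ ZMod L × ZMod M') (Λ'' : Type) [LinearOrder Λ''] [Fintype Λ''] (e'' : Λ'' ≃ ZMod L × ZMod M'') (Λ : Type) [LinearOrder Λ] [Fintype Λ] (e : Λ ≃ ZMod L × ZMod M), d ≤ stiff L M' Λ' e' U δ → d ≤ stiff L M'' Λ'' e'' U δ → d ≤ icomp L M' Λ' e' U δ → d ≤ icomp L M'' Λ'' e'' U δ → icomp L M' Λ'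 e' U δ ≤ k → icomp L M'' Λ'' e'' U δ ≤ k → (Real.pi / 3) ^ 2 / (2 * L) * ((M' : ℝ) * stiff L M' Λ' e' U δ + (M'' : ℝ) * stiff L M'' Λ'' e'' U δ - C) ≤ Es L M Λ e M' U (Real.pi / 3) (Np L M δ) - Es L M Λ e M' U 0 (Np L M δ)

theorem stub_decoupledTwist : StubDecoupledTwist := by
  sorry

/-- STUB S3p (physics; XL; the POINTWISE seam-response form — sharper but riskier than S3, which
it implies via S1 + S4: `gluingTwistMonotone_of_pointwise`). **Twist-sensitivity of the seam
energy.** At every partial seam coupling `t ∈ (0,1]` there are sector ground states `φ` of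
`Hs + Tw 0 + tV` and `ψ` of `Hs + Tw(π/3) + tV` with seam energies
`⟨φ,Vφ⟩ ≤ ⟨ψ,Vψ⟩ + (π/3)²C/(2L)`: after gauging the flux
`π/3` uniformly (`e^{iπ/3L}` per longitudinal bond, `V` is gauge-invariant — its bonds join equal
columns) this is a LOCAL QUADRATIC RESPONSE bound, `O((π/3L)²)` per seam bond × `8L` bonds, for
time-reversal-even bond observables, uniformly in `t` and in the sizes — the statement constructive
RG / Ward-identity methods address (local correlations), unlike the global energy differences of
the crux. Why it might fail: needs absence of level crossings in `θ ∈ [0, π/3]` (pairing), i.e. it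
is false for metallic parts (free fermions: `O(1/√M)` Fermi-surface reshuffling) — hence the
floors; and POINTWISE in `t` it also fails across a level crossing of the seam flow to a LESS stiff
branch (the `t`-derivative of the twist energy jumps there) and is delicate in the number-phase
crossover window `t ∈ (0, t*(L))` where the relative phase of the two tubes locks — the integrated
form S3 is the robust statement. [difficulty: XL] -/
def StubSeamTwistResponse : Prop :=
open Matrix Literature.MathematicalPhysics.QuantumLattice in let H0 : ∀ (L M : ℕ) (Λ : Type) [LinearOrder Λ] [Fintype Λ], (Λ ≃ ZMod L × ZMod M) → ℝ → Matrix (Finset (Orb Λ)) (Finset (Orb Λ)) ℂ := fun _ _ Λ _ _ e U => hamiltonian (SimpleGraph.fromRel fun x y : Λ => y = e.symm ((e x).1 + 1, (e x).2) ∨ y = e.symm ((e x).1, (e x).2 + 1)) 1 U; let Tw : ∀ (L M : ℕ) [NeZero L] [NeZero M] (Λ : Type) [LinearOrder Λ] [Fintype Λ], (Λ ≃ ZMod L × ZMod M) → ℝ → Matrix (Finset (Orb Λ)) (Finset (Orb Λ)) ℂ := fun _ M _ _ _ _ _ e θ => ∑ b : ZMod M, ∑ σ : Fin 2, ((1 -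 Complex.exp (Complex.I * θ)) • (creation (orb (e.symm (0, b)) σ) * annihilation (orb (e.symm (-1, b)) σ)) + (1 - Complex.exp (-(Complex.I * θ))) • (creation (orb (e.symm (-1, b)) σ) * annihilation (orb (e.symm (0, b)) σ))); let E : ∀ (L M : ℕ) [NeZero L] [NeZero M] (Λ : Type) [LinearOrder Λ] [Fintype Λ], (Λ ≃ ZMod L × ZMod M) → ℝ → ℝ → ℕ → ℝ := fun L M _ _ Λ _ _ e U θ N => (H0 L M Λ e U + Tw L M Λ e θ).minEnergyOn (szSector N 0); let Np : ℕ → ℕ → ℝ → ℕ := fun L M δ => 2 * ⌊(1 - δ) * ((L : ℝ) * (M : ℝ)) / 2⌋₊; let stiff : ∀ (L M : ℕ) [NeZero L] [NeZero M] (Λ : Type) [LinearOrder Λ] [Fintype Λ], (Λ ≃ ZMod L × ZMod M) → ℝ → ℝ → ℝ := fun L M _ _ Λ _ _ e U δ => 2 * (L : ℝ) * (E L M Λ e U (Real.pi / 3) (Np L M δ) - E L M Λ e U 0 (Np L M δ)) / ((Real.pi / 3) ^ 2 * (M : ℝ)); let icomp : ∀ (L M : ℕ) [NeZero L] [NeZero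 M] (Λ : Type) [LinearOrder Λ] [Fintype Λ], (Λ ≃ ZMod L × ZMod M) → ℝ → ℝ → ℝ := fun L M _ _ Λ _ _ e U δ => (L : ℝ) * (M : ℝ) * (E L M Λ e U 0 (Np L M δ + 2) + E L M Λ e U 0 (Np L M δ - 2) - 2 * E L M Λ e U 0 (Np L M δ)) / 4; let Hs : ∀ (L M : ℕ) [NeZero M] (Λ : Type) [LinearOrder Λ] [Fintype Λ], (Λ ≃ ZMod L × ZMod M) → ℕ → ℝ → Matrix (Finset (Orb Λ)) (Finset (Orb Λ)) ℂ := fun _ M _ Λ _ _ e M' U => hamiltonian (SimpleGraph.fromRel fun x y : Λ => y = e.symm ((e x).1 + 1, (e x).2) ∨ (((e x).2.val + 1 ≠ M' ∧ (e x).2.val + 1 ≠ M) ∧ y = e.symm ((e x).1, (e x).2 + 1)) ∨ ((e x).2.val + 1 = M' ∧ y = e.symm ((e x).1, 0)) ∨ ((e x).2.val + 1 = M ∧ y = e.symm ((e x).1, ((M' : ℕ) : ZMod M)))) 1 U; let Es : ∀ (L M : ℕ) [NeZero L] [NeZero M] (Λ : Type) [LinearOrder Λ] [Fintype Λ], (Λ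 ≃ ZMod L × ZMod M) → ℕ → ℝ → ℝ → ℕ → ℝ := fun L M _ _ Λ _ _ e M' U θ N => (Hs L M Λ e M' U + Tw L M Λ e θ).minEnergyOn (szSector N 0); ∀ U : ℝ, 0 < U → ∀ δ ∈ Set.Ioo (0 : ℝ) (3 / 10), ∀ d k : ℝ, 0 < d → ∃ C : ℝ, 0 ≤ C ∧ ∃ m₀ L₂ : ℕ, ∀ (L M' M'' M : ℕ) [NeZero L] [NeZero M'] [NeZero M''] [NeZero M], Even L → Even M' → Even M'' → m₀ ≤ M' → m₀ ≤ M'' → M' + M'' = M → M ≤ L → L₂ ≤ L → ∀ (Λ' : Type) [LinearOrder Λ'] [Fintype Λ'] (e' : Λ' ≃ ZMod L × ZMod M') (Λ'' : Type) [LinearOrder Λ''] [Fintype Λ''] (e'' : Λ'' ≃ ZMod L × ZMod M'') (Λ : Type) [LinearOrder Λ] [Fintype Λ] (e : Λ ≃ ZMod L × ZMod M), d ≤ stiff L M' Λ' e' U δ → d ≤ stiff L M'' Λ'' e'' U δ → d ≤ icomp L M' Λ' e' U δ → d ≤ icomp L M'' Λ'' e'' U δ → icomp L M' Λ' e' U δ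 ≤ k → icomp L M'' Λ'' e'' U δ ≤ k → ∀ t ∈ Set.Ioc (0 : ℝ) 1, ∃ φ ψ : Fock (Orb Λ), φ ∈ szSector (Np L M δ) 0 ∧ ψ ∈ szSector (Np L M δ) 0 ∧ star φ ⬝ᵥ φ = 1 ∧ star ψ ⬝ᵥ ψ = 1 ∧ (star φ ⬝ᵥ (Hs L M Λ e M' U + Tw L M Λ e 0 + (t : ℂ) • (H0 L M Λ e U - Hs L M Λ e M' U)) *ᵥ φ).re = (Hs L M Λ e M' U + Tw L M Λ e 0 + (t : ℂ) • (H0 L M Λ e U - Hs L M Λ e M' U)).minEnergyOn (szSector (Np L M δ) 0) ∧ (star ψ ⬝ᵥ (Hs L M Λ e M' U + Tw L M Λ e (Real.pi / 3) + (t : ℂ) • (H0 L M Λ e U - Hs L M Λ e M' U)) *ᵥ ψ).re = (Hs L M Λ e M' U + Tw L M Λ e (Real.pi / 3) + (t : ℂ) • (H0 L M Λ e U - Hs L M Λ e M' U)).minEnergyOn (szSector (Np L M δ) 0) ∧ (star φ ⬝ᵥ (H0 L M Λ e U - Hs L M Λ e M' U) *ᵥ φ).re ≤ (star ψ ⬝ᵥ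 (H0 L M Λ e U - Hs L M Λ e M' U) *ᵥ ψ).re + (Real.pi / 3) ^ 2 / (2 * L) * C

theorem stub_seamTwistResponse : StubSeamTwistResponse := by
  sorry

/-- STUB S3 (physics; XL — the load-bearing seam stub, integrated form). **Closing the seam does not
lower the twist energy by more than `O(1/L)`**: for parts floored by `(d, k)`,
`Es(π/3) − Es(0) ≤ [E_M(π/3) − E_M(0)] + (π/3)²C/(2L)` — the twist energy of the decoupled
two-tube system on the glued carrier is at most that of the glued tube plus a seam-size loss;
in stiffness units: a one-row perturbation changes the total stiffness `M·stiff` by `O(1)`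
(locality of the stiffness DENSITY). Plan: the seam flow `t ↦ Hs + Tw θ + tV` (S1) turns it into
the twist-sensitivity of the seam energy `⟨V⟩_t` (S3p) wherever the flow is smooth; the crossover
window and possible crossings need the integrated bookkeeping (card). Why it might fail: a seam
flow that crosses to a less stiff branch loses exactly the branch stiffness difference; metallic
or striped parts (excluded by the floors only if `(d,k)`-floored tubes are really paired).
[difficulty: XL] -/
def StubGluingTwistMonotone : Prop :=
open Matrix Literature.MathematicalPhysics.QuantumLattice in let H0 : ∀ (L M : ℕ) (Λ : Type) [LinearOrder Λ] [Fintype Λ], (Λ ≃ ZMod L × ZMod M) → ℝ → Matrix (Finset (Orb Λ)) (Finset (Orb Λ)) ℂ := fun _ _ Λ _ _ e U => hamiltonian (SimpleGraph.fromRel fun x y : Λ => y = e.symm ((e x).1 + 1, (e x).2) ∨ y = e.symm ((e x).1, (e x).2 + 1)) 1 U; let Tw : ∀ (L M : ℕ) [NeZero L] [NeZero M] (Λ : Type) [LinearOrder Λ] [Fintype Λ], (Λ ≃ ZMod L × ZMod M) → ℝ → Matrix (Finset (Orb Λ)) (Finset (Orb Λ)) ℂ := fun _ M _ _ _ _ _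 e θ => ∑ b : ZMod M, ∑ σ : Fin 2, ((1 - Complex.exp (Complex.I * θ)) • (creation (orb (e.symm (0, b)) σ) * annihilation (orb (e.symm (-1, b)) σ)) + (1 - Complex.exp (-(Complex.I * θ))) • (creation (orb (e.symm (-1, b)) σ) * annihilation (orb (e.symm (0, b)) σ))); let E : ∀ (L M : ℕ) [NeZero L] [NeZero M] (Λ : Type) [LinearOrder Λ] [Fintype Λ], (Λ ≃ ZMod L × ZMod M) → ℝ → ℝ → ℕ → ℝ := fun L M _ _ Λ _ _ e U θ N => (H0 L M Λ e U + Tw L M Λ e θ).minEnergyOn (szSector N 0); let Np : ℕ → ℕ → ℝ → ℕ := fun L M δ => 2 * ⌊(1 - δ) * ((L : ℝ) * (M : ℝ)) / 2⌋₊; let stiff : ∀ (L M : ℕ) [NeZero L] [NeZero M] (Λ : Type) [LinearOrder Λ] [Fintype Λ], (Λ ≃ ZMod L × ZMod M) → ℝ → ℝ → ℝ := fun L M _ _ Λ _ _ e U δ => 2 * (L : ℝ) * (E L M Λ e U (Real.pi / 3) (Np L M δ) - E L M Λ e U 0 (Np L M δ)) / ((Real.pi / 3) ^ 2 * (M : ℝ));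 let icomp : ∀ (L M : ℕ) [NeZero L] [NeZero M] (Λ : Type) [LinearOrder Λ] [Fintype Λ], (Λ ≃ ZMod L × ZMod M) → ℝ → ℝ → ℝ := fun L M _ _ Λ _ _ e U δ => (L : ℝ) * (M : ℝ) * (E L M Λ e U 0 (Np L M δ + 2) + E L M Λ e U 0 (Np L M δ - 2) - 2 * E L M Λ e U 0 (Np L M δ)) / 4; let Hs : ∀ (L M : ℕ) [NeZero M] (Λ : Type) [LinearOrder Λ] [Fintype Λ], (Λ ≃ ZMod L × ZMod M) → ℕ → ℝ → Matrix (Finset (Orb Λ)) (Finset (Orb Λ)) ℂ := fun _ M _ Λ _ _ e M' U => hamiltonian (SimpleGraph.fromRel fun x y : Λ => y = e.symm ((e x).1 + 1, (e x).2) ∨ (((e x).2.val + 1 ≠ M' ∧ (e x).2.val + 1 ≠ M) ∧ y = e.symm ((e x).1, (e x).2 + 1)) ∨ ((e x).2.val + 1 = M' ∧ y = e.symm ((e x).1, 0)) ∨ ((e x).2.val + 1 = M ∧ y = e.symm ((e x).1, ((M' : ℕ) : ZMod M)))) 1 U; let Es : ∀ (L M : ℕ) [NeZero L] [NeZero M]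 (Λ : Type) [LinearOrder Λ] [Fintype Λ], (Λ ≃ ZMod L × ZMod M) → ℕ → ℝ → ℝ → ℕ → ℝ := fun L M _ _ Λ _ _ e M' U θ N => (Hs L M Λ e M' U + Tw L M Λ e θ).minEnergyOn (szSector N 0); ∀ U : ℝ, 0 < U → ∀ δ ∈ Set.Ioo (0 : ℝ) (3 / 10), ∀ d k : ℝ, 0 < d → ∃ C : ℝ, 0 ≤ C ∧ ∃ m₀ L₂ : ℕ, ∀ (L M' M'' M : ℕ) [NeZero L] [NeZero M'] [NeZero M''] [NeZero M], Even L → Even M' → Even M'' → m₀ ≤ M' → m₀ ≤ M'' → M' + M'' = M → M ≤ L → L₂ ≤ L → ∀ (Λ' : Type) [LinearOrder Λ'] [Fintype Λ'] (e' : Λ' ≃ ZMod L × ZMod M') (Λ'' : Type) [LinearOrder Λ''] [Fintype Λ''] (e'' : Λ'' ≃ ZMod L × ZMod M'') (Λ : Type) [LinearOrder Λ] [Fintype Λ] (e : Λ ≃ ZMod L × ZMod M), d ≤ stiff L M' Λ' e' U δ → d ≤ stiff L M'' Λ'' e'' U δ → d ≤ icomp L M' Λ' e' U δ → d ≤ icomp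 L M'' Λ'' e'' U δ → icomp L M' Λ' e' U δ ≤ k → icomp L M'' Λ'' e'' U δ ≤ k → Es L M Λ e M' U (Real.pi / 3) (Np L M δ) - Es L M Λ e M' U 0 (Np L M δ) ≤ (E L M Λ e U (Real.pi / 3) (Np L M δ) - E L M Λ e U 0 (Np L M δ)) + (Real.pi / 3) ^ 2 / (2 * L) * C

theorem stub_gluingTwistMonotone : StubGluingTwistMonotone := by
  sorry

/-- STUB S5 (physics; XL; NOT decomposed here). **Compressibility seam locality**: parts floored by
`(d, k)` glue with `icomp_M ∈ [min(icomp′, icomp″) − C/M, max(icomp′, icomp″) + C/M]`. Sub-plan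
(card): `E_M(N) = Ês(N) + ∫₀¹⟨V⟩_{t,N} dt` with `Ês` the inf-convolution of the parts' `E(N)` over
particle splits (springs in series: the inf-convolution of discretely convex sequences with second
differences in `[4d/LM′, 4k/LM′]` has second differences giving `icomp_⊕ ∈ [min, max]` up to
`O(1/M)`), plus DENSITY-SMOOTHNESS of the seam energy, `|Δ²_N ∫⟨V⟩| ≤ 4C/(L·M²)` (shell-free
even-`N` staircase — false for free fermions, expected for paired tubes). [difficulty: XL] -/
def StubCompressibilitySeam : Prop :=
open Matrix Literature.MathematicalPhysics.QuantumLattice in let H0 : ∀ (L M : ℕ) (Λ : Type) [LinearOrder Λ] [Fintype Λ], (Λ ≃ ZMod L × ZMod M) → ℝ → Matrix (Finset (Orb Λ)) (Finset (Orb Λ)) ℂ := fun _ _ Λ _ _ e U => hamiltonian (SimpleGraph.fromRel fun x y : Λ => y = e.symm ((e x).1 + 1, (e x).2) ∨ y = e.symm ((e x).1, (e x).2 + 1)) 1 U; let Tw : ∀ (L M : ℕ) [NeZero L] [NeZero M] (Λ : Type) [LinearOrder Λ] [Fintype Λ], (Λ ≃ ZMod L × ZMod M) → ℝ → Matrix (Finset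 (Orb Λ)) (Finset (Orb Λ)) ℂ := fun _ M _ _ _ _ _ e θ => ∑ b : ZMod M, ∑ σ : Fin 2, ((1 - Complex.exp (Complex.I * θ)) • (creation (orb (e.symm (0, b)) σ) * annihilation (orb (e.symm (-1, b)) σ)) + (1 - Complex.exp (-(Complex.I * θ))) • (creation (orb (e.symm (-1, b)) σ) * annihilation (orb (e.symm (0, b)) σ))); let E : ∀ (L M : ℕ) [NeZero L] [NeZero M] (Λ : Type) [LinearOrder Λ] [Fintype Λ], (Λ ≃ ZMod L × ZMod M) → ℝ → ℝ → ℕ → ℝ := fun L M _ _ Λ _ _ e U θ N => (H0 L M Λ e U + Tw L M Λ e θ).minEnergyOn (szSector N 0); let Np : ℕ → ℕ → ℝ → ℕ := fun L M δ => 2 * ⌊(1 - δ) * ((L : ℝ) * (M : ℝ)) / 2⌋₊; let stiff : ∀ (L M : ℕ) [NeZero L] [NeZero M] (Λ : Type) [LinearOrder Λ] [Fintype Λ], (Λ ≃ ZMod L × ZMod M) → ℝ → ℝ → ℝ := fun L M _ _ Λ _ _ e U δ => 2 * (L : ℝ) * (E L M Λ e U (Real.pi / 3) (Np L M δ) - E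 L M Λ e U 0 (Np L M δ)) / ((Real.pi / 3) ^ 2 * (M : ℝ)); let icomp : ∀ (L M : ℕ) [NeZero L] [NeZero M] (Λ : Type) [LinearOrder Λ] [Fintype Λ], (Λ ≃ ZMod L × ZMod M) → ℝ → ℝ → ℝ := fun L M _ _ Λ _ _ e U δ => (L : ℝ) * (M : ℝ) * (E L M Λ e U 0 (Np L M δ + 2) + E L M Λ e U 0 (Np L M δ - 2) - 2 * E L M Λ e U 0 (Np L M δ)) / 4; ∀ U : ℝ, 0 < U → ∀ δ ∈ Set.Ioo (0 : ℝ) (3 / 10), ∀ d k : ℝ, 0 < d → ∃ C : ℝ, 0 ≤ C ∧ ∃ m₀ L₂ : ℕ, ∀ (L M' M'' M : ℕ) [NeZero L] [NeZero M'] [NeZero M''] [NeZero M], Even L → Even M' → Even M'' → m₀ ≤ M' → m₀ ≤ M'' → M' + M'' = M → M ≤ L → L₂ ≤ L → ∀ (Λ' : Type) [LinearOrder Λ'] [Fintype Λ'] (e' : Λ' ≃ ZMod L × ZMod M') (Λ'' : Type) [LinearOrder Λ''] [Fintype Λ''] (e'' : Λ'' ≃ ZMod L × ZMod M'') (Λ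 : Type) [LinearOrder Λ] [Fintype Λ] (e : Λ ≃ ZMod L × ZMod M), d ≤ stiff L M' Λ' e' U δ → d ≤ stiff L M'' Λ'' e'' U δ → d ≤ icomp L M' Λ' e' U δ → d ≤ icomp L M'' Λ'' e'' U δ → icomp L M' Λ' e' U δ ≤ k → icomp L M'' Λ'' e'' U δ ≤ k → min (icomp L M' Λ' e' U δ) (icomp L M'' Λ'' e'' U δ) - C / M ≤ icomp L M Λ e U δ ∧ icomp L M Λ e U δ ≤ max (icomp L M' Λ' e' U δ) (icomp L M'' Λ'' e'' U δ) + C / M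

theorem stub_compressibilitySeam : StubCompressibilitySeam := by
  sorry

/-- Matrix bookkeeping: `(Hs + Tw θ) + (H0 − Hs) = H0 + Tw θ`. [folklore] -/
theorem mat_add_sub {n : Type} [Fintype n] (a b c : Matrix n n ℂ) : a + b + (c - a) = c + b := by
  abel

/-- Real-variable core of the stiffness composition: from the decoupled floor
`θ²(M′s′ + M″s″ − C₁)/(2L) ≤ E⊕(θ) − E⊕(0)` and the seam flow
`E⊕(θ) − E⊕(0) ≤ E_M(θ) − E_M(0) + θ²C₂/(2L)` to
`min(s′,s″) − (C₁+C₂+C₃)/M ≤ 2L(E_M(θ) − E_M(0))/(θ²M)`. [folklore] -/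
theorem seam_arith {EsA EsB EM0 EM1 s' s'' C₁ C₂ C₃ L M M' M'' θ2 : ℝ} (hL : 0 < L) (hM : 0 < M)
    (hθ2 : 0 < θ2) (hsum : M' + M'' = M) (hM' : 0 ≤ M') (hM'' : 0 ≤ M'') (hC3 : 0 ≤ C₃)
    (ha : θ2 / (2 * L) * (M' * s' + M'' * s'' - C₁) ≤ EsB - EsA)
    (hb : EsB - EsA ≤ EM1 - EM0 + θ2 / (2 * L) * C₂) :
    min s' s'' - (C₁ + C₂ + C₃) / M ≤ 2 * L * (EM1 - EM0) / (θ2 * M) := by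
  have hmin : M * min s' s'' ≤ M' * s' + M'' * s'' := by
    rcases le_total s' s'' with h | h
    · rw [min_eq_left h, ← hsum]; nlinarith [mul_le_mul_of_nonneg_left h hM'']
    · rw [min_eq_right h, ← hsum]; nlinarith [mul_le_mul_of_nonneg_left h hM']
  have key1 : θ2 / (2 * L) * (M' * s' + M'' * s'' - C₁ - C₂) ≤ EM1 - EM0 := by
    have e : θ2 / (2 * L) * (M' * s' + M'' * s'' - C₁ - C₂) =
        θ2 / (2 * L) * (M' * s' + M'' * s'' - C₁) - θ2 / (2 * L) * C₂ := by ring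
    rw [e]; linarith
  have key2 : (M' * s' + M'' * s'' - C₁ - C₂) / M ≤ 2 * L * (EM1 - EM0) / (θ2 * M) := by
    have e : (M' * s' + M'' * s'' - C₁ - C₂) / M =
        2 * L * (θ2 / (2 * L) * (M' * s' + M'' * s'' - C₁ - C₂)) / (θ2 * M) := by
      field_simp
    rw [e]
    exact div_le_div_of_nonneg_right (mul_le_mul_of_nonneg_left key1 (by positivity))
      (by positivity)
  have key3 : min s' s'' - (C₁ + C₂ + C₃) / M ≤ (M' * s' + M'' * s'' - C₁ - C₂) / M := by
    rw [le_div_iff₀ hM, sub_mul, div_mul_cancel₀ _ hM.ne']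
    nlinarith
  exact key3.trans key2

/-- Loss weakening, lower form. [folklore] -/
theorem weaken_lo {a b C₃ C M : ℝ} (hM : 0 < M) (hC : C₃ ≤ C) (h : a - C₃ / M ≤ b) :
    a - C / M ≤ b :=
  le_trans (sub_le_sub_left (div_le_div_of_nonneg_right hC hM.le) a) h

/-- Loss weakening, upper form. [folklore] -/
theorem weaken_hi {a b C₃ C M : ℝ} (hM : 0 < M) (hC : C₃ ≤ C) (h : b ≤ a + C₃ / M) :
    b ≤ a + C / M :=
  h.trans (by linarith [div_le_div_of_nonneg_right hC hM.le])

/-- **S1 + S4 + S3p ⇒ S3 (kernel-checked).** With `A = Hs + Tw 0`, `B = Hs + Tw(π/3)`,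
`V = H0 − Hs` (so `A + V = H0 + Tw 0`, `B + V = H0 + Tw(π/3)`, `mat_add_sub`), the seam flow S1 fed
by the regularity facts S4 and the pointwise response S3p is exactly the integrated gluing
monotonicity S3. [folklore] -/
theorem gluingTwistMonotone_of_pointwise (h1 : StubSeamFlow) (h4 : StubRegularity)
    (h3 : StubSeamTwistResponse) : StubGluingTwistMonotone := by
  dsimp only [StubRegularity] at h4
  dsimp only [StubSeamTwistResponse] at h3
  dsimp only [StubGluingTwistMonotone]
  intro U hU δ hδ d k hd
  obtain ⟨C₂, hC₂, m₂, K₂, h3⟩ := h3 U hU δ hδ d k hd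
  refine ⟨C₂, hC₂, m₂, K₂, ?_⟩
  intro L M' M'' M iL iM' iM'' iM hLe hM'e hM''e hm' hm'' hMM hML hL₂ Λ' _ _ e' Λ'' _ _ e'' Λ _ _ e
    f1 f2 f3 f4 f5 f6
  have g1r := h3 L M' M'' M hLe hM'e hM''e hm' hm'' hMM hML hL₂ Λ' e' Λ'' e'' Λ e f1 f2 f3 f4 f5 f6
  obtain ⟨hA, hV, hKA, hKV, hK⟩ := h4 L M Λ e M' U 0 (2 * ⌊(1 - δ) * ((L : ℝ) * (M : ℝ)) / 2⌋₊)
  obtain ⟨hB, -, hKB, -, -⟩ := h4 L M Λ e M' U (Real.pi / 3) (2 * ⌊(1 - δ) * ((L : ℝ) * (M : ℝ)) / 2⌋₊)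
  have flow := h1 _ _ _ _ _ hA hB hV hKA hKB hKV (hK δ hδ) g1r
  rw [mat_add_sub, mat_add_sub] at flow
  clear h1 h3 h4 g1r hA hB hV hKA hKB hKV hK
  convert flow using 3

/-- **Composition (kernel-checked): S2 + S3 + S5 give `CondAdditiveLocality`.** Stiffness: S2 gives
`Δ_⊕ ≥ (π/3)²(M′s′ + M″s″ − C₁)/(2L)`, S3 gives `Δ_M ≥ Δ_⊕ − (π/3)²C₂/(2L)`, hence
`stiff_M = 2LΔ_M/((π/3)²M) ≥ (M′s′ + M″s″)/M − (C₁+C₂)/M ≥ min(s′,s″) − C/M` (`seam_arith`);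
compressibility: S5. Constants `C = C₁ + C₂ + C₃`, `m₀`, `L₂` = maxima. [folklore] -/
theorem condAdditiveLocality_of (h2 : StubDecoupledTwist) (h3 : StubGluingTwistMonotone)
    (h5 : StubCompressibilitySeam) : CondAdditiveLocality := by
  dsimp only [StubDecoupledTwist] at h2
  dsimp only [StubGluingTwistMonotone] at h3
  dsimp only [StubCompressibilitySeam] at h5
  dsimp only [CondAdditiveLocality]
  intro U hU δ hδ d k hd
  obtain ⟨C₁, hC₁, m₁, K₁, h2⟩ := h2 U hU δ hδ d k hd
  obtain ⟨C₂, hC₂, m₂, K₂, h3⟩ := h3 U hU δ hδ d k hd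
  obtain ⟨C₃, hC₃, m₃, K₃, h5⟩ := h5 U hU δ hδ d k hd
  refine ⟨C₁ + C₂ + C₃, by positivity, max m₁ (max m₂ m₃), max K₁ (max K₂ K₃), ?_⟩
  intro L M' M'' M iL iM' iM'' iM hLe hM'e hM''e hm' hm'' hMM hML hL₂ Λ' _ _ e' Λ'' _ _ e'' Λ _ _ e
    f1 f2 f3 f4 f5 f6
  have hm₁' : m₁ ≤ M' := le_trans (le_max_left _ _) hm'
  have hm₁'' : m₁ ≤ M'' := le_trans (le_max_left _ _) hm''
  have hm₂' : m₂ ≤ M' := le_trans ((le_max_left _ _).trans (le_max_right _ _)) hm'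
  have hm₂'' : m₂ ≤ M'' := le_trans ((le_max_left _ _).trans (le_max_right _ _)) hm''
  have hm₃' : m₃ ≤ M' := le_trans ((le_max_right _ _).trans (le_max_right _ _)) hm'
  have hm₃'' : m₃ ≤ M'' := le_trans ((le_max_right _ _).trans (le_max_right _ _)) hm''
  have hK₁ : K₁ ≤ L := le_trans (le_max_left _ _) hL₂
  have hK₂ : K₂ ≤ L := le_trans ((le_max_left _ _).trans (le_max_right _ _)) hL₂
  have hK₃ : K₃ ≤ L := le_trans ((le_max_right _ _).trans (le_max_right _ _)) hL₂
  obtain ⟨g2, g3⟩ := h5 L M' M'' M hLe hM'e hM''e hm₃' hm₃'' hMM hML hK₃ Λ' e' Λ'' e'' Λ e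
    f1 f2 f3 f4 f5 f6
  have g1d := h2 L M' M'' M hLe hM'e hM''e hm₁' hm₁'' hMM hML hK₁ Λ' e' Λ'' e'' Λ e f1 f2 f3 f4 f5 f6
  have flow := h3 L M' M'' M hLe hM'e hM''e hm₂' hm₂'' hMM hML hK₂ Λ' e' Λ'' e'' Λ e f1 f2 f3 f4 f5 f6
  have hL0 : (0 : ℝ) < L := by exact_mod_cast Nat.pos_of_ne_zero (NeZero.ne L)
  have hM0 : (0 : ℝ) < M := by exact_mod_cast Nat.pos_of_ne_zero (NeZero.ne M)
  have hM'0 : (0 : ℝ) ≤ M' := Nat.cast_nonneg _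
  have hM''0 : (0 : ℝ) ≤ M'' := Nat.cast_nonneg _
  have hsum : (M' : ℝ) + M'' = M := by exact_mod_cast hMM
  have hθ : (0 : ℝ) < (Real.pi / 3) ^ 2 := by positivity
  refine ⟨?_, weaken_lo hM0 (le_add_of_nonneg_left (add_nonneg hC₁ hC₂)) g2,
    weaken_hi hM0 (le_add_of_nonneg_left (add_nonneg hC₁ hC₂)) g3⟩
  have key := seam_arith (C₃ := C₃) hL0 hM0 hθ hsum hM'0 hM''0 hC₃ g1d flow
  clear h2 h3 h5 flow g1d g2 g3
  -- `exact key` is accepted too, but only after minutes of kernel reduction (instance subterms of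
  -- the two let-expansions differ syntactically); `convert` bridges them by congruence.
  convert key using 4

end Summit.HubbardSuperconductivity.HubbardSuperconductivity.Cruxes.SeamGluingLocality.SeamFlow
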